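import Mathlib
import HarnessLib
import HarnessLib.Audit
import Summits.QuantumAdvantage.Statement
import Literature.Computability.QuantumComplexity.SignedExactCubicSliceANF
import Literature.Computability.QuantumComplexity.CubicForrelation
import Literature.Computability.QuantumComplexity.Forrelation
import Literature.Computability.Cryptography.ClassBQP
import Literature.Computability.Complexity.Promise
import Literature.Computability.Complexity.PromiseZPPProofs
import Literature.Computability.Complexity.ConstantDepth
import Literature.Computability.Complexity.UniformCircuitClasses
import Literature.Computability.Complexity.Classes
import Literature.Computability.QuantumComplexity.MaioranaMcFarlandKeys
import HarnessLib.Audit.Status.Attr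

/-!
Route: AnfPresentation

# Route AnfPresentation — The signed exact cubic slice in ANF presentation - proved Karp equivalence
with the circuit slice, an AC0[parity]-cap-P rung, a declared BPP-lift residual (root, refines
CubicForrelation r3)

DECOMPOSITION CELL decomp-qadv (D-0178/D-0179), RESIDUAL MODE, node AnfPresentation (lens
decomp-qadv-lens-3 g2 «one certified translation + a split
beneath»; NODE 2026-08-30T03:53:46Z, v1 sha256 883120fb… = cleared file of record, v2 8df2abd6… = v1
+ pure additions (first rung PROVED), 2116
lines, lean check rc0 · 0 sorry · axioms standard; critic decomp-qadv-crit-1 g2 row 19 CLEARED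
04:06:37Z). ROOT CURRENCY: the deciding theorem
concludes `QuantumAdvantage` itself, re-using route CubicForrelation's binders r2 `NearExactIsExact`
(stmt-QuantumAdvantage-14043, open) and K2
`SignedExactSliceIsLift` (stmt-14830, PROVED) VERBATIM (shared items) and REFINING its residual r3
`SignedExactCubicForrelationNotPrBPP`
(stmt-13932, the cell's BLOCKER #1, A03-grade). It suffices to show X = r3_ANF = AnfResidual — «the
signed EXACT cubic Forrelation slice, instances
given as PAIRS OF CUBIC ANF TABLES (n, F, G) (a constant bit + a full n³ coefficient table each; yes
Φ = +1, no Φ = −1, n even), is not in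
PromiseBPP'» — because X ⟺ r3 is PROVED both ways in the node (support AnfEquiv = E_pres
`parentResidual_iff_anfResidual`: two kernel-checked KARP
REDUCTIONS `anf_reducible_slice` / `slice_reducible_anf` with CodeFP certificates, composed with the
landed closure
`PromiseProblem.mem_PromiseBPP'_of_polyTimeReducible_holds'`), and X is split as RungA ∧ LiftA
(`pieces_iff_parentResidual`, no strength smuggled):
RungA = «the ANF slice is not in promiseLift(AC⁰[⊕] ∩ P)» (crux r2, NECESSARY, strictly weaker,
FLOOR-FREE, contentful, with stated deciding tests) and
LiftA = RungA → X (crux r3, the DECLARED RESIDUAL: the BPP-vs-AC⁰[⊕] gap of the sign problem,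
A03-class, undivided). WHY THE TRANSLATION HAS TEETH
(cell law W-slice, critic 02:23:10Z (3)): at CIRCUIT grain every restricted-class rung «slice ∉
promiseLift 𝒞» is void (the instance format is a
white box whose evaluation is P-complete); at ANF grain evaluating F is a parity of ≤ n³
conjunctions (AC⁰[⊕]), the yes/no sets are images of an
injective plain encoding, and class rungs measure the SIGN PROBLEM OF EXACT PAIRS itself — by bent
duality the sign of an exact pair (F, G = F̃ ⊕ c)
is c = G(0) ⊕ s(F) with s(F) the sign of Σₓ(−1)^F(x), an AFFINE INVARIANT of the cubic bent F; the
ANF ladder asks in which classes s(F) is computable.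
Lean: `Literature.Computability.QuantumComplexity.SignedExactCubicSliceANF ∉
Literature.Computability.Complexity.PromiseBPP'`

## Assembly
Inside `closes` (glue.lean, five lines of logic, 0 sorry): `h₃ := hE.mpr (p₂ p₁)` is
CubicForrelation's r3 verbatim (E_pres applied to LiftA applied to
RungA); then the PARENT's certified script: by_contra ¬QuantumAdvantage ⇒ BQP ⊆ BPP pointwise ⇒
promiseLift BQP ⊆ promiseLift BPP ⊆ PromiseBPP'
(`promiseLift_mono`, `PromiseBPP_subset_PromiseBPP'_holds`) applied to K2 h₂ h₁ puts the signed
exact slice in PromiseBPP', contradicting h₃. Binders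
consumed 5/5 (open cruxes RungA, LiftA, NearExactIsExact; supports SignedExactSliceIsLift PROVED =
stmt-14830 and AnfEquiv PROVED in the node). Node
kernel evidence: `closes` / `closes_residual` / `r3_of` / `pieces_iff_parentResidual`
(AnfPresentation.lean v2 :2000–2040 region; writer sketch
sk/AnfPresentationSketch.lean: 12 Iff.rfl incl. ↔ CubicForrelation.NearExactIsExact /
.SignedExactSliceIsLift by tree name, anfEquiv_holds, closes, rc0).

Rationale: WHY THIS LINE. The lens changes the INSTANCE GRAIN of the blocker, not its strength: r3 at circuit
grain admits no meaningful intermediate class rung, r3 at ANF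
grain admits a whole ladder (AC⁰ ⊊ AC⁰[⊕] ∩ P ⊊ … ⊊ BPP) whose bottom rungs are theorems of circuit
complexity. The first rung is already
PROVED in the node (v2 §W): `quadRungAC0_of_parity (h : PARITY ∉ AC⁰) : QuadRungAC0` — PARITY ≤_proj
the sign of the IP-shifted
Maiorana–McFarland pairs F_u = ⟨x′,x″⟩ ⊕ ⟨u,x′⟩ ⊕ ⟨1,x″⟩ ⊕ 1, G_u = ⟨y′,y″⟩ ⊕ ⟨1,y′⟩ ⊕ ⟨u,y″⟩ (bent
duality Φ(F_u,G_u) = −(−1)^|u|,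
kernel-checked `Witness.famPair_value`; the instance code is a projection of u; AC⁰ is
projection-closed, `Circuit.exists_project`), with h the
tree theorem `Literature.Barriers.PneNP.PARITY_not_mem_AC0` (Håstad) taken by name only because its
module's olean is unbuilt on the farm. Imported
areas and sources: promise-problem reductions and closure of prBPP (Arora–Barak §1.3; tree `CodeFP*`
kits, `PromiseBPPClosureProofs`); Boolean bent
functions and duality (Rothaus; Mesnager 2016 Prop 7.1.14; Dickson/Arf for the quadratic grade);
constant-depth lower bounds (Håstad; Razborov–Smolensky
doi:10.1145/28395.28404 for the AC⁰[⊕] grade; ⊕L-completeness of 𝔽₂-linear algebra,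
Buntrock–Damm–Hertrampf–Meinel doi:10.1007/BF01578841, for the
un-mixing test); white-box vs black-box Forrelation (Bravyi–Gosset–Grier–Schaeffer arXiv:2102.06963
p.5: black-box lower bounds «do not rule out an
efficient classical algorithm that can look inside the black box»; Aaronson–Ambainis arXiv:1411.5729
Prop 6; Raz–Tal; Girish–Raz–Zhan arXiv:2007.03631).

RANKED CRUXES. #0 AnfResidual (target) — X = r3_ANF (rank-0 record of the refined residual): the
signed exact cubic Forrelation slice in ANF presentation — the landed Literature promise problem
`SignedExactCubicSliceANF` (defn-SignedExactCubicSliceANF: instances (n, F, G), F, G : CubicForm n =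
constant bit + n³ coefficient table, value forrelation F.eval G.eval, yes Φ = 1 / no Φ = −1, n even)
— is not in PromiseBPP'. EQUIVALENT to CubicForrelation's r3 (stmt-13932) by the PROVED E_pres
(support AnfEquiv); hence exactly as open and as A03-exposed as r3 (residual grade) — its role is to
carry the class ladder RungAC0 / RungP / RungA / … which is contentful only at this grain. [deps:
RungA, LiftA, AnfEquiv] [difficulty: open-problem] (why it might fail: exactly when r3 fails: an
explicit prBPP sign algorithm for exact cubic pairs (e.g. MM-structure peeling made total: every
planted MM family tried so far was solved with 0 wrong signs, PairFinderExact → ¬r3 landed) — E_pres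
transports any such algorithm to the ANF slice.) [arXiv:1411.5729, arXiv:2102.06963,
doi:10.1017/cbo9780511976667]
#2 RungA (crux) — P1, the AC⁰[⊕] ∩ P RUNG of the ANF ladder: the ANF slice is not in
promiseLift(AC0Mod 2 ∩ P) — no polynomial-time language decided by constant-depth polynomial-size
circuits with parity gates separates the Φ = +1 table-pairs from the Φ = −1 table-pairs;
equivalently the affine invariant s(F) of cubic bent functions with cubic duals is not an AC⁰[⊕] ∩ P
function of the pair of tables. NECESSARY (node `rungA_of_anfResidual`: PromiseP ⊆ PromiseBPP',
promiseLift_mono) · strictly WEAKER (sub-BPP class) · FLOOR-FREE (a class statement at a grain where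
the W-slice law does not bite) · CONTENTFUL · UNDECIDED with STATED TESTS: T-ANF-1 (Q_Arf⁺) is
Arf(Q) of a nondegenerate quadratic form over 𝔽₂ computable in AC⁰[⊕] from (B_Q, B_Q⁻¹, diag)? —
decides the quadratic grade QuadRungA outright; T-ANF-2 (un-mixing) hidden MM cubic pairs (x′·π(x″)
⊕ h(x″)) ∘ A: in identity coordinates the sign h(π⁻¹(0)) is AC⁰[⊕]-EASY (degenerate-witness pass),
so hardness must come from un-mixing A (rank/solve over 𝔽₂, ⊕L-complete) or from non-MM pairs;
T-ANF-3 census of s(F) over all cubic bent F with cubic dual at n = 6, 8 against small depth-2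
AC⁰[⊕] formulas. ATTACKABLE both ways (prove: MAJ/MOD₃ ≤_proj sign via mixing + Razborov–Smolensky;
refute: an explicit AC⁰[⊕] ∩ P sign formula) · INSTRUMENTABLE (T-ANF-3). Critic caution (M-test): if
QuadRungA is provable by a MAJ ≤_proj Arf-on-promise reduction, RungA is a theorem shadow and the
split degenerates to §R — still worth landing as an unconditional AC⁰[⊕] lower bound for the slice.
[difficulty: L] (why it might fail: an explicit AC⁰[⊕] ∩ P formula for the sign of exact cubic pairs
may exist — at the quadratic grade Arf(Q) from (B_Q, B_Q⁻¹) might be AC⁰[⊕] (test T-ANF-1), and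
identity-coordinate MM pairs ARE AC⁰[⊕]-easy (T-ANF-2); hardness needs hidden mixing to be
necessary.) [doi:10.1145/28395.28404, doi:10.1007/BF01578841, arXiv:2102.06963, arXiv:1411.5729]
#3 LiftA (crux) — P2, the DECLARED RESIDUAL · NO-SHRINK (≡ X once RungA holds; `liftA_iff`;
necessary vacuously, `liftA_of_anfResidual`): from «the ANF slice ∉ promiseLift(AC⁰[⊕] ∩ P)» to «the
ANF slice ∉ PromiseBPP'» — the BPP-vs-AC⁰[⊕] gap of the sign problem of exact cubic pairs, i.e. the
summit's own difficulty at this node, undivided. COSTUME-class by its consequent (A03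
SeparationPrerequisites: an unconditional prBQP ⊄ prBPP′-strength statement), declared as such;
BARRIER-tagged in the text (natural proofs bite every rung 𝒞 ⊇ TC⁰ on the way up). Filed so the
route is honest about what separates RungA from X; not expected to shrink. [deps: RungA]
[difficulty: open-problem] (why it might fail: it is X-hard given RungA: a prBPP (even P) sign
algorithm using un-mixing by Gaussian elimination (outside AC⁰[⊕]) would make RungA true and X false
— exactly the T-ANF-2 world.) [arXiv:1411.5729, doi:10.1017/cbo9780511976667, arXiv:2102.06963]
#4 NearExactIsExact (crux) — r2 of route CubicForrelation (stmt-QuantumAdvantage-14043, body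
VERBATIM — shared item, staffed there): RIGIDITY OF NEAR-EXACT CUBIC PAIRS — some θ < 1 such that
every pair of 𝔽₂-degree-≤3 Boolean functions on an even number of variables with forrelation > θ has
forrelation exactly 1. Load-bearing binder of closes exactly as in the parent (it puts the signed
exact slice into promiseLift BQP through K2). [difficulty: open-problem] (why it might fail: a
sequence of cubic pairs with Φ → 1 from below without ever being exact (bent g with NON-cubic dual
close to RM(3): Φ = 1 − 2·dist(g̃, RM(3,n))/2ⁿ; known caps 3/4, 7/8 leave room above).)
[arXiv:1411.5729, doi:10.1017/cbo9780511976667]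
#9 SignedExactSliceIsLift (support) — K2 of route CubicForrelation (stmt-QuantumAdvantage-14830,
body VERBATIM — shared item, PROVED:
`Theorems.SignedExactSliceIsLift.signedExactSliceIsLift_holds`): NearExactIsExact ⟹ the signed exact
cubic slice (circuit presentation) ∈ promiseLift BQP (Hadamard-test family on interpolated cubic
ANFs, AND-amplified). [deps: NearExactIsExact] [difficulty: S] [arXiv:1411.5729]
#9 AnfEquiv (support) — E_pres, THE ONE EQUIV OF THE LENS, PROVED BOTH WAYS in the node
(`parentResidual_iff_anfResidual`, hypothesis-free, axioms standard): CubicForrelation's r3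
(stmt-13932, body verbatim on the left) ↔ AnfResidual. Directions = genuine Karp reductions between
code-promises: ANF ≤ₚ circuits (parse the table code, list the monomials, emit K2's canonical
XOR-of-ANDs netlists — certificate `K2.stub_anfEmitFP`; value, degree, well-formedness preserved)
and circuits ≤ₚ ANF (degree-3 truncated MÖBIUS coefficients of both circuit oracles at the clamped
arity — certificate `K2.stub_coeffFP`; exactness on cubic oracles = K2's RM(3) algebra
`stub_moebius`), composed with the landed
`PromiseProblem.mem_PromiseBPP'_of_polyTimeReducible_holds'`. Load-bearing binder of closes.
LANDING: the node VENDORS ≈ 690 lines of the accepted K2 certificate modules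
(`…SignedExactSliceIsLift{StubAnfEmitFP, StubAnfCircuitAux, main part 2, StubCoeffFP}`) because
their hub oleans are unbuilt since the 2026-08-24 world build (critic chk/IMP.lean: bare imports
rc75, OPS FLAG 04:06:07Z); the Theorems proposal must import the tree modules once rebuilt —
«PROVED, landing blocked on farm rebuild, not on mathematics» (prover task). [difficulty: M]
[arXiv:1411.5729, doi:10.1017/cbo9780511976667]
#9 QuadRungAC0 (support) — aside — THE FIRST RUNG of the ANF ladder, PROVED in the node v2 modulo
the by-name hypothesis PARITY ∉ AC⁰ (`quadRungAC0_of_parity`; h = tree theorem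
`Literature.Barriers.PneNP.PARITY_not_mem_AC0`, LocalityProofs.lean:802, sorry-free, olean unbuilt
on the farm): the QUADRATIC sub-slice of the ANF slice (both tables without genuinely cubic entries)
is not in promiseLift AC⁰ — PARITY ≤_proj its sign problem via the IP-shifted Maiorana–McFarland
pairs (bent duality Φ(F_u, G_u) = −(−1)^|u|, `Witness.famPair_value`; projection
`Witness.isProj_encode`; code length ≤ 96t³+48t²+16t+16; AC⁰ projection closure
`Circuit.exists_project`). A decided rung in a regime where the summit is open, exercising exactly
the lever; BC5 witness of the route (plan-only until LocalityProofs is rebuilt, then a one-line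
Theorems file). [difficulty: S] [doi:10.1145/28395.28404, arXiv:1411.5729]
#9 RungAC0 (support) — aside — the AC⁰ rung for the full ANF slice (PROVED in node v2 from PARITY ∉
AC⁰ via QuadRungAC0, `rungAC0_of_parity`; implies RungP; incomparable with RungA): no constant-depth
polynomial-size family signs exact cubic ANF pairs. [difficulty: S] [doi:10.1145/28395.28404]
#9 QuadRungA (support) — aside — the QUADRATIC grade of RungA (WEAKER: a sub-promise;
`rungA_of_quadRungA`): the quadratic sub-slice is not in promiseLift(AC0Mod 2 ∩ P). DECIDED by test
T-ANF-1 (Q_Arf⁺: is the Arf invariant of a nondegenerate quadratic form computable in AC⁰[⊕] from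
(B_Q, B_Q⁻¹, diag)?): yes ⇒ QuadRungA FALSE by an explicit family; no ⇒ prove it via ⊕L-hardness of
𝔽₂-linear algebra + Razborov–Smolensky. The natural first prover/refuter target above the proved AC⁰
rung. [difficulty: M] [doi:10.1007/BF01578841, doi:10.1145/28395.28404]
#9 RungP (support) — aside — the parity-free uniform rung AC⁰ ∩ P (WEAKER than RungA,
`rungP_of_rungA`; PROVED in node v2 from PARITY ∉ AC⁰, `rungP_of_parity`). [difficulty: S]
[doi:10.1145/28395.28404]
#9 RungANonuniform (support) — aside — the NON-UNIFORM AC⁰[⊕] rung (STRONGER than RungA,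
`rungA_of_rungANonuniform`; correctly not a binder): the ANF slice is not in promiseLift(AC0Mod 2).
[difficulty: L] [doi:10.1145/28395.28404]
#9 RungAUniform (support) — aside — the DLOGTIME-uniform AC⁰[⊕] rung (necessary for X modulo the
textbook inclusion UniformAC0Mod 2 ⊆ P, which the tree does not yet hold:
`rungAUniform_of_anfResidual (hUP)`). [difficulty: L] [doi:10.1145/28395.28404]
#9 FirstRungEdges (support) — aside, PROVED in the node (0 sorry): the ladder's edges — QuadRungAC0
→ RungAC0 → RungP, RungA → RungP, QuadRungA → RungA, RungANonuniform → RungA, AnfResidual → RungA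
(sub-promise inclusions and promiseLift monotonicity). [difficulty: S] [arXiv:1411.5729]

TWO-LAYER PLAN. RungA ⇐ stub_quadRungA (the quadratic grade, decided by T-ANF-1: Arf from (B_Q,
B_Q⁻¹, diag) is ⊕L-hard under projections, then Razborov–Smolensky
gives «not AC⁰[⊕]» and the P-intersection is handled by the promise-lift semantics) → stub_unmix
(cubic MM pairs: computing the sign requires
UN-MIXING the hidden affine A — a projection of 𝔽₂ rank/solve — so MAJ/MOD₃ ≤_proj sign; non-MM
pairs handled by ExactPairsMaioranaMcFarland-type
structure or left as the named gap) → RungA (BC3 skeleton bc-anf/RungA_birth.lean). LiftA is a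
declared residual: not decomposed (its content is the
class ladder AC⁰[⊕] ∩ P ⊊ TC⁰ ⊊ NC ⊊ P ⊊ BPP above the natural-proofs line).

KILL CRITERIA. An explicit AC⁰[⊕] ∩ P (or any P) algorithm for the sign of exact cubic ANF pairs
refutes RungA AND, through E_pres and LiftA's vacuity, does NOT by
itself refute X — but a P algorithm refutes X and r3 together (PairFinderExact-type kill, already
the parent's refutation-first lane): close --reason
refuted:RungA if only the AC⁰[⊕] rung dies with X alive (re-glue on the next rung TC⁰/NC), close the
route and flag CubicForrelation:13932 if a prBPP
sign algorithm appears. r2 NearExactIsExact refuted kills this route together with the parent's cone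
(shared binder). T-ANF-1 answered «yes» kills
QuadRungA only (aside) and redirects RungA to genuinely cubic pairs.

NOT DECOMPOSED YET. RungA is ONE block until T-ANF-1 / T-ANF-2 are answered (they decide whether the
quadratic grade and the un-mixing step carry the difficulty); LiftA
stays whole by design (residual). The vendored K2 plumbing is a landing concern, not a
decomposition.

CHEAPEST FALSIFIER. T-ANF-1 on paper / in Lean (a lookup-sized question): is Arf(Q) of a
nondegenerate quadratic form over 𝔽₂, given (B_Q, B_Q⁻¹, diagonal), computable
by constant-depth parity circuits? The dual table hands over B⁻¹ for free, so the usual ⊕L-hardness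
of rank does not apply verbatim — if Arf is a
low-degree 𝔽₂ polynomial in (B, B⁻¹, diag) entries then QuadRungA is FALSE by an explicit family and
RungA's content moves to cubic pairs; if it
still encodes an ⊕L-complete quantity, QuadRungA (hence RungA's quadratic face) is a
Razborov–Smolensky theorem. Second: T-ANF-3 census (s(F) over
all cubic bent F with cubic dual at n = 6, 8 vs small depth-2 AC⁰[⊕] formulas; kit minutes) — an
exact small formula would be a strong refutation
signal for RungA. Neither run yet (kit_allowed = false for lens and writer).

NUMBERS. Witness family (node §W, kernel): code length of the IP-shifted MM pair at half-dimension t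
≤ 96t³ + 48t² + 16t + 16; Φ(F_u, G_u) = −(−1)^|u|
exactly. E_pres reductions: table code ↦ XOR-of-ANDs netlists of ≤ n³ + n² + n + 1 monomials per
oracle; circuit code ↦ degree-3 truncated Möbius
table at clamped arity m = min n (|x|+1). Parent data carried (not re-measured): every planted MM
family tried (n ≤ 96, > 600 pairs, 4 finders)
solved with 0 wrong signs (r3's refutation-first record). No item names a constant beyond class
indices (AC0Mod 2, degree 3).

DEFINITION REQUESTS. None: `SignedExactCubicSliceANF`, `CubicForm`, `CubicANFPair` are LANDED
Literature definitions (defn-SignedExactCubicSliceANF); `IsQuadForm` (node) is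
inlined into QuadRungAC0 / QuadRungA as `∀ i j l, I.F.cube i j l = true → (i = j ∨ j = l ∨ i = l)`;
classes `AC0`, `AC0Mod`, `UniformAC0Mod`,
`Classes.P`, `promiseLift`, `PromiseBPP'` are tree constants (lean search --decl verified by
elaboration of the writer sketch, rc0).

Novelty: Searches (2026-08-30, lens + writer): tree `rg 'ANF|coefficient table|SignedExactCubicSliceANF'
Summits/QuantumAdvantage` (hits: the landed defn file and K2's interpolation stubs only; no route
states r3 at ANF grain); lens: `lit search --hybrid "white-box forrelation classical algorithm look
inside the black box"` → [corpus:paper:arxiv-2102.06963 p.5] BGGS21 (graph-forrelation = the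
quadratic white-box case: treewidth algorithm Thm 4, #P-hardness of relative-error approximation);
`lit galaxy search "XOR of Forrelations|Forrelation lower bound|k-fold Forrelation" --star all` →
[galaxy:pdf:-2796889426134799940] Girish–Raz–Zhan arXiv:2007.03631, [galaxy:pdf:7938028299702823900]
Chen–Wang arXiv:1811.07515 (black-box); no hits for "Arf invariant AC0" / "sign of quadratic
exponential sum parity-L" in corpus (fts+vec) and galaxy; writer: `lit search "Arf invariant
constant depth circuits parity"` → no relevant hits (corpus+crossref: Arf invariant in
topology/coding only).
Nearest prior art found: in tree, route CubicForrelation (r3 at circuit grain; hidden-MM dictionary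
items 2205/14671; lens-2 g2 KeyDichotomy stratifying INSTANCES by key type — this node stratifies
SOLVERS by circuit class at a fixed presentation and composes with it); in print, BGGS21
arXiv:2102.06963 (white-box quadratic forrelation) and the black-box Forrelation lower bounds
(Raz–Tal, Aaronson–Ambainis arXiv:1411.5729, GRZ arXiv:2007.03631) which do not address white-box
structure.
Delta: the first presentation  [refs: 2007.03631, 1811.07515, 2102.06963, 1411.5729, paper:arxiv-2102.06963]

Barriers (technique_class: structural-reduction, razborov-smolensky, natural-proofs): - technique_class: structural-reduction, razborov-smolensky, natural-proofs
- Literature.Barriers.QuantumAdvantage.SeparationPrerequisites: BITES X, LiftA and the shared r3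
lineage (an unconditional prBQP ⊄ prBPP′-strength statement, P ≠ PP / BPP ≠ PSPACE territory) —
honest: «it does; the bet is the ladder» — which is WHY LiftA is a DECLARED RESIDUAL (A03-class) and
the route's earned content is RungA and the rungs below it, all strictly inside classes with
unconditional lower bounds; the barrier does not quantify over RungA (AC⁰[⊕] ∩ P vs a promise
problem).
- Literature.Barriers.QuantumAdvantage.NaturalProofs: does NOT bite the filed rungs (AC⁰, AC⁰[⊕]:
Håstad / Razborov–Smolensky are available, no pseudorandom functions in the class); it bites every
rung 𝒞 ⊇ TC⁰ on the way from RungA to X — recorded on LiftA.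
- Literature.Barriers.QuantumAdvantage.Relativization: not invoked — every statement is white-box
and unrelativized (explicit promise problems on ANF tables; the black-box Forrelation bounds of
Raz–Tal / Aaronson–Ambainis are cited as NON-applicable to white-box structure, BGGS21 p.5).
- Literature.Barriers.QuantumAdvantage.Algebrization: idem — no oracle, no algebrizing technique;
class rungs at constant depth.
- Literature.Barriers.QuantumAdvantage.PromiseLiftRelativization: the only promise LIFT in the cone
is K2 (signed exact slice ∈ promiseLift BQP), a PROVED shared item; RungA/LiftA are promise-lift
MEMBERSHIP NEGATIONS for explicit classical classes, outside t

History (route lifecycle, newest last):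
- 2026-08-30T06:14:12Z · rev 2: informal re-worded for QuadRungA (planner-decomp-qadv-writer-1-g3-0)
- 2026-08-30T12:14:34Z · rev 3: informal re-worded for RungA (planner-decomp-qadv-writer-1-g5-0)
- 2026-08-30T12:46:44Z · rev 4: informal re-worded for RungANonuniform, RungA (planner-decomp-qadv-writer-1-g5-0)
- 2026-08-30T13:48:40Z · rev 5: informal re-worded for RungANonuniform (planner-decomp-qadv-writer-1-g5-0)
- 2026-08-30T14:43:56Z · rev 6: informal re-worded for RungA, RungANonuniform (planner-decomp-qadv-writer-1-g5-0)
- 2026-08-30T21:43:29Z · RESIDUAL declared: LiftA (stmt-QuantumAdvantage-27984) — summit-strength until shown otherwise: writer g7 schema sync (D-0170): residual flag = the route's DECLARED RESIDUAL exactly as its critic-cleared node/docstri (planner-decomp-qadv-writer-1-g7-0)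

sub-problem: QuantumAdvantage · status: draft · opened planner-decomp-qadv-writer-1-g2-0 2026-08-30T04:42:38Z · rev 6 · ledger route-QuantumAdvantage-AnfPresentation
GENERATED by the gate from the ledger (D-0016/17). Provers cite these decls: `theorem foo : Summit.QuantumAdvantage.QuantumAdvantage.Theses.AnfPresentation.<Decl> := …` in Summits/QuantumAdvantage/QuantumAdvantage/Theorems/<Name>.lean.
-/

namespace Summit.QuantumAdvantage.QuantumAdvantage.Theses.AnfPresentation

open scoped BigOperators Topology Manifold Classical MeasureTheory ProbabilityTheory Matrix InnerProductSpace ComplexConjugate ContinuousMap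
open Filter Set Function TopologicalSpace MeasureTheory

attribute [summit_statement] _root_.QuantumAdvantage

open Literature.QuantumAdvantage

/-- item stmt-QuantumAdvantage-27982 · target · rank 0 · open · by planner
why it might fail: exactly when r3 fails: an explicit prBPP sign algorithm for exact cubic pairs (e.g. MM-structure peeling made total: every planted MM family tried so far was solved with 0 wrong signs, PairFinderExact → ¬r3 landed) — E_pres transports any such algorithm to the ANF slice.
sources: arXiv:1411.5729, arXiv:2102.06963, doi:10.1017/cbo9780511976667
[target] X = r3_ANF (rank-0 record of the refined residual): the signed exact cubic Forrelation
slice in ANF presentation — the landed Literature promise problem `SignedExactCubicSliceANF`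
(defn-SignedExactCubicSliceANF: instances (n, F, G), F, G : CubicForm n = constant bit + n³
coefficient table, value forrelation F.eval G.eval, yes Φ = 1 / no Φ = −1, n even) — is not in
PromiseBPP'. EQUIVALENT to CubicForrelation's r3 (stmt-13932) by the PROVED E_pres (support
AnfEquiv); hence exactly as open and as A03-exposed as r3 (residual grade) — its role is to carry
the class ladder RungAC0 / RungP / RungA / … which is contentful only at this grain. [deps: RungA,
LiftA, AnfEquiv] [difficulty: open-problem] -/
@[route_item "route-QuantumAdvantage-AnfPresentation"]
def AnfResidual : Prop :=
  Literature.Computability.QuantumComplexity.SignedExactCubicSliceANF ∉ Literature.Computability.Complexity.PromiseBPP'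

/-- item stmt-QuantumAdvantage-27983 · crux · leaf ATTACKABLE · rank 2 · open · by planner
why it might fail: an explicit AC⁰[⊕] ∩ P formula for the sign of exact cubic pairs may exist — at the quadratic grade Arf(Q) from (B_Q, B_Q⁻¹) might be AC⁰[⊕] (test T-ANF-1), and identity-coordinate MM pairs ARE AC⁰[⊕]-easy (T-ANF-2); hardness needs hidden mixing to be necessary.
sources: doi:10.1145/28395.28404, doi:10.1007/BF01578841, arXiv:2102.06963, arXiv:1411.5729
[crux] P1, the AC⁰[⊕] ∩ P RUNG of the ANF ladder: the ANF slice is not in promiseLift(AC0Mod 2 ∩ P)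
— no polynomial-time language decided by constant-depth polynomial-size circuits with parity gates
separates the Φ = +1 table-pairs from the Φ = −1 table-pairs; equivalently the affine invariant s(F)
of cubic bent functions with cubic duals is not an AC⁰[⊕] ∩ P function of the pair of tables.
NECESSARY (node `rungA_of_anfResidual`: PromiseP ⊆ PromiseBPP', promiseLift_mono) · strictly WEAKER
(sub-BPP class) · FLOOR-FREE (a class statement at a grain where the W-slice law does not bite) ·
CONTENTFUL · UNDECIDED with STATED TESTS: T-ANF-1 (Q_Arf⁺) is Arf(Q) of a nondegenerate quadratic
form over 𝔽₂ computable in AC⁰[⊕] from (B_Q, B_Q⁻¹, diag)? — decides the quadratic grade QuadRungA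
outright; T-ANF-2 (un-mixing) hidden MM cubic pairs (x′·π(x″) ⊕ h(x″)) ∘ A: in identity coordinates
the sign h(π⁻¹(0)) is AC⁰[⊕]-EASY (degenerate-witness pass), so hardness must come from un-mixing A
(rank/solve over 𝔽₂, ⊕L-complete) or from non-MM pairs; T-ANF-3 census of s(F) over all cubic bent F
with cubic dual at n = 6, 8 against small depth-2 AC⁰[⊕] formulas. ATTACKABLE both ways (prove:
MAJ/MOD₃ ≤_pro -/
@[route_item "route-QuantumAdvantage-AnfPresentation", crux (bottleneck := work) (source := "ledger D-0171 leaf tag ATTACKABLE on stmt-QuantumAdvantage-27983, 2026-09-01")]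
def RungA : Prop :=
  Literature.Computability.QuantumComplexity.SignedExactCubicSliceANF ∉ Literature.Computability.Complexity.promiseLift (Literature.Computability.Complexity.AC0Mod 2 ∩ Literature.Computability.Complexity.Classes.P)

/-- item stmt-QuantumAdvantage-27984 · crux · RESIDUAL (gen 0; summit-strength until shown otherwise, D-0170) · leaf IDEA-NEEDED · rank 3 · open · by planner
why it might fail: it is X-hard given RungA: a prBPP (even P) sign algorithm using un-mixing by Gaussian elimination (outside AC⁰[⊕]) would make RungA true and X false — exactly the T-ANF-2 world.
sources: arXiv:1411.5729, doi:10.1017/cbo9780511976667, arXiv:2102.06963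
[crux] P2, the DECLARED RESIDUAL · NO-SHRINK (≡ X once RungA holds; `liftA_iff`; necessary
vacuously, `liftA_of_anfResidual`): from «the ANF slice ∉ promiseLift(AC⁰[⊕] ∩ P)» to «the ANF slice
∉ PromiseBPP'» — the BPP-vs-AC⁰[⊕] gap of the sign problem of exact cubic pairs, i.e. the summit's
own difficulty at this node, undivided. COSTUME-class by its consequent (A03
SeparationPrerequisites: an unconditional prBQP ⊄ prBPP′-strength statement), declared as such;
BARRIER-tagged in the text (natural proofs bite every rung 𝒞 ⊇ TC⁰ on the way up). Filed so the
route is honest about what separates RungA from X; not expected to shrink. [deps: RungA]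
[difficulty: open-problem] -/
@[route_item "route-QuantumAdvantage-AnfPresentation", crux (bottleneck := idea) (source := "ledger wanted_by.residual on stmt-QuantumAdvantage-27984, 2026-09-01")]
def LiftA : Prop :=
  RungA → Literature.Computability.QuantumComplexity.SignedExactCubicSliceANF ∉ Literature.Computability.Complexity.PromiseBPP'

/-- item stmt-QuantumAdvantage-14043 · crux · rank 4 · open · by planner
why it might fail: a sequence of cubic pairs with Φ → 1 from below without ever being exact (bent g with NON-cubic dual close to RM(3): Φ = 1 − 2·dist(g̃, RM(3,n))/2ⁿ; known caps 3/4, 7/8 leave room above).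
sources: arXiv:1411.5729, doi:10.1017/cbo9780511976667
[crux] ISOLATION OF EXACTNESS (rank 2; replaces the refuted CubicStability, route-choice
2026-08-16): there is an absolute θ < 1 such that for every even n and all Boolean f, g of 𝔽₂-degree
≤ 3, Φ(f,g) > θ ⇒ Φ(f,g) = 1 (g bent with dual exactly f; DuttaMaitraMukherjee2024 §3). Conjectured
sharp constant θ = 7/8, ATTAINED: T-family (refuter 494f1478 on stmt-2202) b = y′·T(y″), T =
(y₁,y₂,y₃,y₄+y₁y₂,y₅+y₃y₄), a = cubic truncation of the quartic dual, n = 10, Φ = 7/8. What it does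
for the line: above θ the signed cubic 2-fold problem IS the signed exact slice (r3 = X at threshold
θ; CruxAtThreshold / crux_of_threshold in Cruxes/SignedCubicForrelationInPrBPP/Disproof.lean §2), so
the exact slice is representative of everything near ±1; the band [3/5, θ] — where the refutation
witnesses live (P₄ n=12 Φ=625/1024; n=8 pair Φ=39/64; P₂ 25/32; T^{⊗3} 0.670; P₂⊗T 0.684), all
decomposable with blockwise-trivial |Φ| and sign — is left to r7's anchor/block programme, not to
localisation. Known mechanisms and caps: one-sided Kasami–Tokura perturbation Φ = 1 − 2·wt ≤ 3/4;
bent g with NON-cubic dual: Φ = 1 − 2·dist(g̃, RM(3,n))/2ⁿ ≤ 7/8 when deg g̃ = 4 (d_min RM(4,n) =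
2ⁿ/16), while Hou's bound de -/
@[route_item "route-QuantumAdvantage-AnfPresentation", crux]
def NearExactIsExact : Prop :=
  ∃ θ : ℝ, θ < 1 ∧ ∀ n : ℕ, Even n → ∀ f g : (Fin n → Bool) → Bool, Literature.Computability.QuantumComplexity.IsDegLeFun 3 f → Literature.Computability.QuantumComplexity.IsDegLeFun 3 g → θ < Literature.Computability.QuantumComplexity.forrelation f g → Literature.Computability.QuantumComplexity.forrelation f g = 1

/-- item stmt-QuantumAdvantage-27985 · support · rank 9 · open · by planner
sources: arXiv:1411.5729
[support] K2 of route CubicForrelation (stmt-QuantumAdvantage-14830, body VERBATIM — shared item,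
PROVED: `Theorems.SignedExactSliceIsLift.signedExactSliceIsLift_holds`): NearExactIsExact ⟹ the
signed exact cubic slice (circuit presentation) ∈ promiseLift BQP (Hadamard-test family on
interpolated cubic ANFs, AND-amplified). [deps: NearExactIsExact] [difficulty: S] -/
@[route_item "route-QuantumAdvantage-AnfPresentation", crux]
def SignedExactSliceIsLift : Prop :=
  NearExactIsExact → (⟨Literature.Computability.QuantumComplexity.KForrelationInstance.encode '' {I | I.IsOverB2 ∧ I.value = 1 ∧ I.k = 2 ∧ Even I.n ∧ ∀ i, Literature.Computability.QuantumComplexity.IsDegLeFun 3 (I.C i).eval}, Literature.Computability.QuantumComplexity.KForrelationInstance.encode '' {I | I.IsOverB2 ∧ I.value = -1 ∧ I.k = 2 ∧ Even I.n ∧ ∀ i, Literature.Computability.QuantumComplexity.IsDegLeFun 3 (I.C i).eval}⟩ : Literature.Computability.Complexity.PromiseProblem) ∈ Literature.Computability.Complexity.promiseLift Literature.Computability.Cryptography.BQP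

/-- item stmt-QuantumAdvantage-27986 · support · rank 9 · open · by planner
sources: arXiv:1411.5729, doi:10.1017/cbo9780511976667
[support] E_pres, THE ONE EQUIV OF THE LENS, PROVED BOTH WAYS in the node
(`parentResidual_iff_anfResidual`, hypothesis-free, axioms standard): CubicForrelation's r3
(stmt-13932, body verbatim on the left) ↔ AnfResidual. Directions = genuine Karp reductions between
code-promises: ANF ≤ₚ circuits (parse the table code, list the monomials, emit K2's canonical
XOR-of-ANDs netlists — certificate `K2.stub_anfEmitFP`; value, degree, well-formedness preserved)
and circuits ≤ₚ ANF (degree-3 truncated MÖBIUS coefficients of both circuit oracles at the clamped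
arity — certificate `K2.stub_coeffFP`; exactness on cubic oracles = K2's RM(3) algebra
`stub_moebius`), composed with the landed
`PromiseProblem.mem_PromiseBPP'_of_polyTimeReducible_holds'`. Load-bearing binder of closes.
LANDING: the node VENDORS ≈ 690 lines of the accepted K2 certificate modules
(`…SignedExactSliceIsLift{StubAnfEmitFP, StubAnfCircuitAux, main part 2, StubCoeffFP}`) because
their hub oleans are unbuilt since the 2026-08-24 world build (critic chk/IMP.lean: bare imports
rc75, OPS FLAG 04:06:07Z); the Theorems proposal must import the tree modules once rebuilt —
«PROVED, landing blocked on farm rebuild, not on mathemati -/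
@[route_item "route-QuantumAdvantage-AnfPresentation", crux]
def AnfEquiv : Prop :=
  ((⟨Literature.Computability.QuantumComplexity.KForrelationInstance.encode '' {I | I.IsOverB2 ∧ I.value = 1 ∧ I.k = 2 ∧ Even I.n ∧ ∀ i, Literature.Computability.QuantumComplexity.IsDegLeFun 3 (I.C i).eval}, Literature.Computability.QuantumComplexity.KForrelationInstance.encode '' {I | I.IsOverB2 ∧ I.value = -1 ∧ I.k = 2 ∧ Even I.n ∧ ∀ i, Literature.Computability.QuantumComplexity.IsDegLeFun 3 (I.C i).eval}⟩ : Literature.Computability.Complexity.PromiseProblem) ∉ Literature.Computability.Complexity.PromiseBPP') ↔ AnfResidual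

/-- item stmt-QuantumAdvantage-27987 · aside · rank 9 · closed · proved by Summit.QuantumAdvantage.QuantumAdvantage.Theorems.HintDial.anfPresentation_quadRungAC0 (prover) · by planner
sources: doi:10.1145/28395.28404, arXiv:1411.5729
[support] aside — THE FIRST RUNG of the ANF ladder, PROVED in the node v2 modulo the by-name
hypothesis PARITY ∉ AC⁰ (`quadRungAC0_of_parity`; h = tree theorem
`Literature.Barriers.PneNP.PARITY_not_mem_AC0`, LocalityProofs.lean:802, sorry-free, olean unbuilt
on the farm): the QUADRATIC sub-slice of the ANF slice (both tables without genuinely cubic entries)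
is not in promiseLift AC⁰ — PARITY ≤_proj its sign problem via the IP-shifted Maiorana–McFarland
pairs (bent duality Φ(F_u, G_u) = −(−1)^|u|, `Witness.famPair_value`; projection
`Witness.isProj_encode`; code length ≤ 96t³+48t²+16t+16; AC⁰ projection closure
`Circuit.exists_project`). A decided rung in a regime where the summit is open, exercising exactly
the lever; BC5 witness of the route (plan-only until LocalityProofs is rebuilt, then a one-line
Theorems file). [difficulty: S] -/
@[route_item "route-QuantumAdvantage-AnfPresentation"]
def QuadRungAC0 : Prop :=
  (⟨Literature.Computability.QuantumComplexity.CubicANFPair.encode '' {I | (Even I.n ∧ I.value = 1) ∧ (∀ i j l, I.F.cube i j l = true → (i = j ∨ j = l ∨ i = l)) ∧ (∀ i j l, I.G.cube i j l = true → (i = j ∨ j = l ∨ i = l))}, Literature.Computability.QuantumComplexity.CubicANFPair.encode '' {I | (Even I.n ∧ I.value = -1) ∧ (∀ i j l, I.F.cube i j l = true → (i = j ∨ j = l ∨ i = l)) ∧ (∀ i j l, I.G.cube i j l = true → (i = j ∨ j = l ∨ i = l))}⟩ : Literature.Computability.Complexity.PromiseProblem) ∉ Literature.Computability.Complexity.promiseLift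 Literature.Computability.Complexity.AC0

-- `QuadRungAC0` holds: proved by `Summit.QuantumAdvantage.QuantumAdvantage.Theorems.HintDial.anfPresentation_quadRungAC0` (its module imports this route file, so no `_holds` link can be stated here).

/-- item stmt-QuantumAdvantage-27988 · aside · rank 9 · closed · proved by Summit.QuantumAdvantage.QuantumAdvantage.Theorems.HintDial.anfPresentation_rungAC0 (prover) · by planner
sources: doi:10.1145/28395.28404
[support] aside — the AC⁰ rung for the full ANF slice (PROVED in node v2 from PARITY ∉ AC⁰ via
QuadRungAC0, `rungAC0_of_parity`; implies RungP; incomparable with RungA): no constant-depth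
polynomial-size family signs exact cubic ANF pairs. [difficulty: S] -/
@[route_item "route-QuantumAdvantage-AnfPresentation"]
def RungAC0 : Prop :=
  Literature.Computability.QuantumComplexity.SignedExactCubicSliceANF ∉ Literature.Computability.Complexity.promiseLift Literature.Computability.Complexity.AC0

-- `RungAC0` holds: proved by `Summit.QuantumAdvantage.QuantumAdvantage.Theorems.HintDial.anfPresentation_rungAC0` (its module imports this route file, so no `_holds` link can be stated here).

/-- item stmt-QuantumAdvantage-27989 · aside · rank 9 · open · by planner
sources: doi:10.1007/BF01578841, doi:10.1145/28395.28404
[support] aside — the QUADRATIC grade of RungA (WEAKER: a sub-promise; `rungA_of_quadRungA`): the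
quadratic sub-slice is not in promiseLift(AC0Mod 2 ∩ P). STATUS 2026-08-30 (lens-3 g3 NODE «ArfPin»
§Q Theorem Q; critic row 27 CLEARED 05:41:12Z): REFUTED ON PAPER — the sign of an exact QUADRATIC
pair is the Arf invariant, computable in AC⁰[⊕]∩P from (U, C = B⁻¹ mod 2) by the det-mod-8 rule
`Arf(q_U) = [det S ≡ ±3 (mod 8)]`, det S mod 8 = 1 + 2·tr(XM) + 4·e₂(CM) with one 2-adic Newton step
X = C(2I − KC) (Levine's criterion + odd-Pfaffian lift); n = 4 KERNEL CERTIFICATE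
decomp-qadv-lens-3/g3/ArfCertificate4.lean (`cert4`: all 2¹⁰ upper-triangular tables by `decide`,
`cert4_count = 448`, std axioms); independent numeric reproduction by the critic (754 nonsingular
forms n ≤ 10, 0 mismatches) and by the lens to n = 14. Test T-ANF-1 thereby DECIDED: yes ⇒ QuadRungA
FALSE. NOT closed `refuted` until the refuter-lane landing `theorem not_quadRungA : ¬ QuadRungA`
(needs `ArfFormulaCorrect` for all n — typed in node §Q QuadFace, writer-inlined signature ready in
the writer folder rt-anf/ArfFormulaCorrect.sig — plus the AC0Mod 2 ∩ P rendering of arfFormula,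
§W-style plumbing; M/L). OPEN as an -/
@[route_item "route-QuantumAdvantage-AnfPresentation"]
def QuadRungA : Prop :=
  (⟨Literature.Computability.QuantumComplexity.CubicANFPair.encode '' {I | (Even I.n ∧ I.value = 1) ∧ (∀ i j l, I.F.cube i j l = true → (i = j ∨ j = l ∨ i = l)) ∧ (∀ i j l, I.G.cube i j l = true → (i = j ∨ j = l ∨ i = l))}, Literature.Computability.QuantumComplexity.CubicANFPair.encode '' {I | (Even I.n ∧ I.value = -1) ∧ (∀ i j l, I.F.cube i j l = true → (i = j ∨ j = l ∨ i = l)) ∧ (∀ i j l, I.G.cube i j l = true → (i = j ∨ j = l ∨ i = l))}⟩ : Literature.Computability.Complexity.PromiseProblem) ∉ Literature.Computability.Complexity.promiseLift (Literature.Computability.Complexity.AC0Mod 2 ∩ Literature.Computability.Complexity.Classes.P)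

/-- item stmt-QuantumAdvantage-27990 · aside · rank 9 · closed · proved by Summit.QuantumAdvantage.QuantumAdvantage.Theorems.HintDial.anfPresentation_rungP (prover) · by planner
sources: doi:10.1145/28395.28404
[support] aside — the parity-free uniform rung AC⁰ ∩ P (WEAKER than RungA, `rungP_of_rungA`; PROVED
in node v2 from PARITY ∉ AC⁰, `rungP_of_parity`). [difficulty: S] -/
@[route_item "route-QuantumAdvantage-AnfPresentation"]
def RungP : Prop :=
  Literature.Computability.QuantumComplexity.SignedExactCubicSliceANF ∉ Literature.Computability.Complexity.promiseLift (Literature.Computability.Complexity.AC0 ∩ Literature.Computability.Complexity.Classes.P)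

-- `RungP` holds: proved by `Summit.QuantumAdvantage.QuantumAdvantage.Theorems.HintDial.anfPresentation_rungP` (its module imports this route file, so no `_holds` link can be stated here).

/-- item stmt-QuantumAdvantage-27991 · aside · rank 9 · open · by planner
sources: doi:10.1145/28395.28404
[support] aside — the NON-UNIFORM AC⁰[⊕] rung (STRONGER than RungA, `rungA_of_rungANonuniform`;
correctly not a binder): the ANF slice is not in promiseLift(AC0Mod 2). [difficulty: L] SIGN RECORD
(2026-08-30; lens-3 g7 «SignDial» node de39a6b3, 1297 l, farm rc0 · 0 sorry · 0 warn · axioms std ·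
bc7 6/6 CLEAN; critic row 56 VERIFIED MEDIUM; NO items — AnfPresentation at cap): ONE certified
EQUIV RungANonuniform (27991 ⊒ 27983) ⟺ SignRungNU := «the slice IS the SIGN PROBLEM of a bent
cubic: ε(F) = F̃(0) = [Σ(−1)^F < 0] given F and its NORMALISED dual» (kernel both ways: ⟸
sub-promise; ⟹ one-bit surgery `flip_realise` inside AC⁰[⊕], depth +2, size 2(s+N+1)+1); split
beneath SignRungNU ⟺ SignDepthTwo ∧ DepthClimbNU (`rungANonuniform_iff_split`): S = SignDepthTwo [W
· NECESSARY · WEAKER · OPEN · ATTACKABLE: covering law `rect_le` (Lindsey) + `sepVariety_le` PROVED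
⇒ on paper every ∨- /∧-topped depth-2 AC⁰[⊕] circuit deciding BentSign on ONE translation orbit has ≥
2^(n/2−1) gates; the third form ⊕∘∧ SOLVES translation orbits in poly size (`eps_eq`) ⇒ the fight is
on HIDDEN FRAMES F∘A where the answer reads B = A^{−T} (`dualBit_affine`); INSTRUMENTABLE T-SIGN-1
(sparse-separator / literal -/
@[route_item "route-QuantumAdvantage-AnfPresentation"]
def RungANonuniform : Prop :=
  Literature.Computability.QuantumComplexity.SignedExactCubicSliceANF ∉ Literature.Computability.Complexity.promiseLift (Literature.Computability.Complexity.AC0Mod 2)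

/-- item stmt-QuantumAdvantage-27992 · aside · rank 9 · open · by planner
sources: doi:10.1145/28395.28404
[support] aside — the DLOGTIME-uniform AC⁰[⊕] rung (necessary for X modulo the textbook inclusion
UniformAC0Mod 2 ⊆ P, which the tree does not yet hold: `rungAUniform_of_anfResidual (hUP)`).
[difficulty: L] -/
@[route_item "route-QuantumAdvantage-AnfPresentation"]
def RungAUniform : Prop :=
  Literature.Computability.QuantumComplexity.SignedExactCubicSliceANF ∉ Literature.Computability.Complexity.promiseLift (Literature.Computability.Complexity.UniformAC0Mod 2)

/-- item stmt-QuantumAdvantage-27993 · aside · rank 9 · closed · proved by Summit.QuantumAdvantage.QuantumAdvantage.Theorems.HintDial.anfPresentation_firstRungEdges (prover) · by planner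
sources: arXiv:1411.5729
[support] aside, PROVED in the node (0 sorry): the ladder's edges — QuadRungAC0 → RungAC0 → RungP,
RungA → RungP, QuadRungA → RungA, RungANonuniform → RungA, AnfResidual → RungA (sub-promise
inclusions and promiseLift monotonicity). [difficulty: S] -/
@[route_item "route-QuantumAdvantage-AnfPresentation"]
def FirstRungEdges : Prop :=
  (QuadRungAC0 → RungAC0) ∧ (RungAC0 → RungP) ∧ (RungA → RungP) ∧ (QuadRungA → RungA) ∧ (RungANonuniform → RungA) ∧ (AnfResidual → RungA)

-- `FirstRungEdges` holds: proved by `Summit.QuantumAdvantage.QuantumAdvantage.Theorems.HintDial.anfPresentation_firstRungEdges` (its module imports this route file, so no `_holds` link can be stated here).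

/-- item stmt-QuantumAdvantage-29123 · aside · rank 9 · closed · proved by Summit.QuantumAdvantage.QuantumAdvantage.Theorems.HintDial.anfPresentation_coreEdges (prover) · by planner
sources: doi:10.1145/28395.28404, doi:10.1007/BF01578841, arXiv:1910.00785
[aside] CoreEdges — ORDER/LOCATION RECORD of the CUBIC CORE of RungA (lens-3 g3 NODE «ArfPin»
2026-08-30T05:07:19Z, node decomp-qadv-lens-3/g3/AnfPresentation.lean v3.1 sha256 38b1d713…; critic
decomp-qadv-crit-1 row 27 CLEARED 05:41:12Z, filing (c): «CoreRungA/MMCoreRungA + edges as ONE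
record item like 27993»). With pL := promiseLift(AC0Mod 2 ∩ P), quadS := the quadratic exact
sub-slice (= 27989's promise), coreS := the GENUINELY CUBIC exact sub-slice (some cube entry off the
degenerate diagonal i=j∨j=l∨i=l), mmS := its Maiorana–McFarland-presented part (F an MM bent
function with key π over the landed Literature `MaioranaMcFarland.IsMMKeyOf`): (CoreRungA → RungA) ∧
(MMCoreRungA → CoreRungA) ∧ (Dispatch → QuadEasyA → (RungA ↔ CoreRungA)), where CoreRungA := coreS ∉
pL, MMCoreRungA := mmS ∉ pL, QuadEasyA := quadS ∈ pL (= ¬QuadRungA, Theorem Q of the node: TRUE on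
paper, n = 4 kernel certificate ArfCertificate4.cert4 / cert4_count = 448, critic reproduction 754
forms 0 mismatches), Dispatch := (quadS ∈ pL → coreS ∈ pL → SignedExactCubicSliceANF ∈ pL) (r5 at
ANF grain: dispatch on the syntactic quadratic/cubic split). ALL THREE CONJUNCTS PROVED in the node
(rungA_of_coreRungA, coreR -/
@[route_item "route-QuantumAdvantage-AnfPresentation"]
def CoreEdges : Prop :=
  let pL := Literature.Computability.Complexity.promiseLift (Literature.Computability.Complexity.AC0Mod 2 ∩ Literature.Computability.Complexity.Classes.P); let quad : Literature.Computability.QuantumComplexity.CubicANFPair → Prop := fun I => (∀ i j l, I.F.cube i j l = true → (i = j ∨ j = l ∨ i = l)) ∧ (∀ i j l, I.G.cube i j l = true → (i = j ∨ j = l ∨ i = l)); let mm : Literature.Computability.QuantumComplexity.CubicANFPair → Prop := fun I => ∃ (m : ℕ) (e : I.n = m + m) (π : (Fin m → Bool) ≃ (Fin m → Bool)), Literature.Computability.QuantumComplexity.MaioranaMcFarland.IsMMKeyOf (fun y : Fin (m + m) → Bool => I.F.eval fun i => y (Fin.cast e i)) π; let quadS : Literature.Computability.Complexity.PromiseProblem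 := ⟨Literature.Computability.QuantumComplexity.CubicANFPair.encode '' {I | (Even I.n ∧ I.value = 1) ∧ quad I}, Literature.Computability.QuantumComplexity.CubicANFPair.encode '' {I | (Even I.n ∧ I.value = -1) ∧ quad I}⟩; let coreS : Literature.Computability.Complexity.PromiseProblem := ⟨Literature.Computability.QuantumComplexity.CubicANFPair.encode '' {I | (Even I.n ∧ I.value = 1) ∧ ¬ quad I}, Literature.Computability.QuantumComplexity.CubicANFPair.encode '' {I | (Even I.n ∧ I.value = -1) ∧ ¬ quad I}⟩; let mmS : Literature.Computability.Complexity.PromiseProblem := ⟨Literature.Computability.QuantumComplexity.CubicANFPair.encode '' {I | ((Even I.n ∧ I.value = 1) ∧ ¬ quad I) ∧ mm I}, Literature.Computability.QuantumComplexity.CubicANFPair.encode '' {I | ((Even I.n ∧ I.value = -1) ∧ ¬ quad I) ∧ mm I}⟩; (coreS ∉ pL → RungA) ∧ (mmS ∉ pL → coreS ∉ pL) ∧ ((quadS ∈ pL → coreS ∈ pL → Literature.Computability.QuantumComplexity.SignedExactCubicSliceANF ∈ pL) → quadS ∈ pL → (RungA ↔ coreS ∉ pL))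

-- `CoreEdges` holds: proved by `Summit.QuantumAdvantage.QuantumAdvantage.Theorems.HintDial.anfPresentation_coreEdges` (its module imports this route file, so no `_holds` link can be stated here).

/-- item stmt-QuantumAdvantage-27994 · assembly · rank 1 · open · by planner
sources: arXiv:1411.5729, arXiv:2102.06963
[assembly] NearExactIsExact → SignedExactSliceIsLift → RungA → LiftA → AnfEquiv → QuantumAdvantage;
the same script as closes (`assembly_holds` in the writer sketch). -/
@[route_item "route-QuantumAdvantage-AnfPresentation"]
def Assembly : Prop :=
  NearExactIsExact → SignedExactSliceIsLift → RungA → LiftA → AnfEquiv → QuantumAdvantage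

/-! D-0027 §2.1 — DECIDING THEOREM (planner-authored via `route open/edit --closes-file`; by planner-decomp-qadv-writer-1-g2-0 2026-08-30T04:42:38Z):
its hypotheses are this route's items and its conclusion the sub-problem Statement (glue_lint), and it elaborates with this file. -/

/-- Deciding theorem of route AnfPresentation (decomp-qadv lens 3 gen 2, ROOT currency): `hE.mpr (p₂ p₁)` is CubicForrelation's residual r3
verbatim (the proved presentation equivalence E_pres applied to the declared residual LiftA applied to the rung RungA); then the parent's certified
script: if `QuantumAdvantage` failed, BQP ⊆ BPP pointwise, so `promiseLift BQP ⊆ promiseLift BPP ⊆ PromiseBPP'` (`promiseLift_mono`,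
`PromiseBPP_subset_PromiseBPP'_holds`) applied to K2 `h₂ h₁` puts the signed exact cubic slice in `PromiseBPP'`, contradicting r3. -/
@[closes "route-QuantumAdvantage-AnfPresentation"] theorem closes (h₁ : NearExactIsExact) (h₂ : SignedExactSliceIsLift) (p₁ : RungA) (p₂ : LiftA) (hE : AnfEquiv) : QuantumAdvantage := by
  have h₃ := hE.mpr (p₂ p₁)
  by_contra hQA
  refine h₃ (Literature.Computability.Complexity.PromiseBPP_subset_PromiseBPP'_holds
    (Literature.Computability.Complexity.promiseLift_mono (fun L hL => ?_) (h₂ h₁)))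
  by_contra hLn
  exact hQA ⟨L, hL, hLn⟩

end Summit.QuantumAdvantage.QuantumAdvantage.Theses.AnfPresentation
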